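import Summits.CriticalPhenomena.SAWScalingLimit.Theorems.SAWDevelopingMapObservableToSLETypeLadderResidue
import Summits.CriticalPhenomena.SAWScalingLimit.Theorems.SAWDevelopingMapObservableToSLETypeLadderNoMacroBacktracking
import Summits.CriticalPhenomena.SAWScalingLimit.Theorems.SAWDevelopingMapObservableToSLETypeLadderBandIteration
import Summits.CriticalPhenomena.SAWScalingLimit.Theses.SAWSpinMonotone
import HarnessLib

/-!
# Crux `SAWDevelopingMap.ObservableToSLE` (stmt-CriticalPhenomena-10472), line `six-class-type-ladder`, r17:
# THE CRUX FROM ITS BAND-WISE RESIDUE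

Landing target:
`Summits/CriticalPhenomena/SAWScalingLimit/Theorems/SAWDevelopingMapObservableToSLETypeLadderBandResidue.lean`
(`--supports stmt-CriticalPhenomena-10472`; lead prover-line-stmt-CriticalPhenomena-10472-c6-0; registered carrier
`stub_bandResidue_carrier`).

After r13 (lead c5) the crux was `ObservableToSLE ⇐ {S1 = item 17698 (abundance), T1⁻ = item 17955, T5ₐ = item 7148}`
(`TypeLadder.observableToSLE_of_residue`, p163920).  This lead (c6) cut the abundance: S1 is asked conditionally on the crux's
own hypotheses and on the simplicity co-residue (r14), the macroscopic-backtracking species is a THEOREM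
(`TypeLadder.stub_noMacroBacktracking`, p168181: `HexTight → 7148 → NoMacroBacktracking`), and the remaining abundance follows
from BAND-WISE RENEWAL (`BandRenewal`, vocabulary `…TypeLadderBandDefs.lean` p168396: per band, one end at a time, uniform over
self-avoiding pasts confined to the inner ball) by the kernel-checked BAND ITERATION `TypeLadder.stub_bandIteration`
(pieces p169149 prefix conditioning = exact domain Markov, p168826, p168809, p169043, reversal p169608, one-end bound, assembly).

* `observableToSLE_of_bandResidue` — **THE CRUX FROM ITS r17 RESIDUE**: `ObservableToSLE` from EXACTLY three research inputs:
  (R1) band-wise renewal under the crux hypotheses and simplicity — the registered stub `stub_bandRenewal` of the skeleton r16/r17,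
  the recommended successor ITEM of stmt-17698; (T1⁻) macroscopic source locality = item stmt-17955 verbatim; (T5ₐ) simplicity of
  subsequential limits = item stmt-7148 by name.
* `observableToSLE_spinMonotone_of_bandResidue` — the same for the bet route's copy `SAWSpinMonotone.ObservableToSLE` (`Iff.rfl`).
-/

noncomputable section

open scoped BigOperators Topology NNReal ENNReal Classical BoundedContinuousFunction
open Filter Set MeasureTheory Metric
open Literature.Probability.LatticeModels (HexVertex hexGraph hexCenter triZeta triEmbed Site polyline)
open Literature.Probability.RandomPlanarGeometry
open Literature.Probability.RandomPlanarGeometry.SAW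
open UpperHalfPlane (upperHalfPlaneSet)

namespace Summit.CriticalPhenomena.SAWScalingLimit.Theorems.ObservableToSLE.TypeLadder

open Summit.CriticalPhenomena.SAWScalingLimit.Theses.SAWDevelopingMap (HexObservableLimit HexTight ObservableToSLE)
open Summit.CriticalPhenomena.SAWScalingLimit.Theses.SAWLatticeVirasoro (HexSimpleSubseqLimits)
open Summit.CriticalPhenomena.SAWScalingLimit.Theorems.ObservableToSLER.BridgeGate
open Summit.CriticalPhenomena.SAWScalingLimit.Theorems.ObservableToSLER.NestedGate

/-- **Registered carrier `stub_bandResidue_carrier`** (crux item stmt-CriticalPhenomena-10472, r17): the ε-bookkeeping of the two-end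
assembly — two thirds make less than a whole. -/
theorem stub_bandResidue_carrier : ∀ ε : ℝ, 0 < ε → ε / 3 + ε / 3 < ε := by
  intro ε hε
  linarith

/-- **THE CRUX FROM ITS r17 RESIDUE (kernel-checked).**  `ObservableToSLE` from (R1) band-wise renewal at both ends under the crux's
hypotheses and the simplicity co-residue (`stub_bandRenewal`'s statement), (T1⁻) macroscopic source locality (item 17955 verbatim) and
(T5ₐ) simplicity of subsequential limits (item 7148): the abundance of widely linked first good gates is supplied by the band iteration
`stub_bandIteration` fed with (R1) and the no-backtracking theorem `stub_noMacroBacktracking`, and the rest is the r13 residue theorem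
`observableToSLE_of_residue`. -/
theorem observableToSLE_of_bandResidue
    (hR1 : HexObservableLimit → HexTight → HexSimpleSubseqLimits →
      ∀ (D : DobrushinDomain) (a b : ℝ → HexVertex), IsEmbEndpointApprox hexGraph hexCenter D a b → BandRenewal D a b)
    (h5a1 :
      ∀ (E : DobrushinDomain) (ρ : ℝ) (Λ : ℝ → Finset HexVertex) (m₀ : ℝ → ℤ)
        (a : ℝ → Sym2 HexVertex),
        0 < ρ → E.carrier ∩ ball (E.pt 0) ρ = {z : ℂ | (E.pt 0).im < z.im} ∩ ball (E.pt 0) ρ →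
        (∀ᶠ δ : ℝ in 𝓝[>] 0, hexDomainSimplyConnected (Λ δ) ∧
          (hexGraph.induce (↑(Λ δ) : Set HexVertex)).Preconnected ∧ a δ ∈ hexDomainBoundary (Λ δ) ∧
          (∀ v ∈ Λ δ, (δ : ℂ) * hexCenter v ∈ E.carrier) ∧
          (∀ v : HexVertex, (δ : ℂ) * hexCenter v ∈ ball (E.pt 0) ρ → (v ∈ Λ δ ↔ m₀ δ ≤ v.1 1))) →
        (∀ K : Set ℂ, IsCompact K → K ⊆ E.carrier →
          ∀ᶠ δ : ℝ in 𝓝[>] 0, ∀ v : HexVertex, (δ : ℂ) * hexCenter v ∈ K → v ∈ Λ δ) →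
        Tendsto (fun δ : ℝ => (δ : ℂ) * hexMidpoint (a δ)) (𝓝[>] 0) (𝓝 (E.pt 0)) →
        ∀ ε : ℝ, 0 < ε → ∀ r : ℝ, 0 < r → ∃ t₀ : ℝ, 0 < t₀ ∧
          ∀ (s : ℝ → Sym2 HexVertex) (t : ℝ), t ≠ 0 → |t| < t₀ →
            (∀ᶠ δ : ℝ in 𝓝[>] 0, s δ ∈ hexDomainBoundary (Λ δ) ∧
              (hexMidpoint (s δ)).im = (hexMidpoint (a δ)).im) →
            Tendsto (fun δ : ℝ => (δ : ℂ) * hexMidpoint (s δ)) (𝓝[>] 0) (𝓝 (E.pt 0 + t)) →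
            ∀ᶠ δ : ℝ in 𝓝[>] 0,
              (∑ γ : HexMidEdgeSAW (Λ δ) (a δ) (s δ),
                  if ∃ v ∈ γ.verts, r ≤ dist ((δ : ℂ) * hexCenter v) ((δ : ℂ) * hexMidpoint (a δ))
                  then hexCriticalFugacity ^ γ.length else 0) ≤
                ε * ∑ γ : HexMidEdgeSAW (Λ δ) (a δ) (s δ), hexCriticalFugacity ^ γ.length)
    (h7148 : HexSimpleSubseqLimits) :
    ObservableToSLE := fun hO hT =>
  observableToSLE_of_residue
    (stub_bandIteration (hR1 hO hT h7148) (fun D a b hab => stub_noMacroBacktracking hT h7148 D a b hab))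
    h5a1 h7148 hO hT

/-- The bet route's copy (`route-CriticalPhenomena-SAWSpinMonotone`): `SAWSpinMonotone.ObservableToSLE` from the same r17 residue
(the two route decls and their hypotheses are the same terms). -/
theorem observableToSLE_spinMonotone_of_bandResidue
    (hR1 : HexObservableLimit → HexTight → HexSimpleSubseqLimits →
      ∀ (D : DobrushinDomain) (a b : ℝ → HexVertex), IsEmbEndpointApprox hexGraph hexCenter D a b → BandRenewal D a b)
    (h5a1 :
      ∀ (E : DobrushinDomain) (ρ : ℝ) (Λ : ℝ → Finset HexVertex) (m₀ : ℝ → ℤ)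
        (a : ℝ → Sym2 HexVertex),
        0 < ρ → E.carrier ∩ ball (E.pt 0) ρ = {z : ℂ | (E.pt 0).im < z.im} ∩ ball (E.pt 0) ρ →
        (∀ᶠ δ : ℝ in 𝓝[>] 0, hexDomainSimplyConnected (Λ δ) ∧
          (hexGraph.induce (↑(Λ δ) : Set HexVertex)).Preconnected ∧ a δ ∈ hexDomainBoundary (Λ δ) ∧
          (∀ v ∈ Λ δ, (δ : ℂ) * hexCenter v ∈ E.carrier) ∧
          (∀ v : HexVertex, (δ : ℂ) * hexCenter v ∈ ball (E.pt 0) ρ → (v ∈ Λ δ ↔ m₀ δ ≤ v.1 1))) →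
        (∀ K : Set ℂ, IsCompact K → K ⊆ E.carrier →
          ∀ᶠ δ : ℝ in 𝓝[>] 0, ∀ v : HexVertex, (δ : ℂ) * hexCenter v ∈ K → v ∈ Λ δ) →
        Tendsto (fun δ : ℝ => (δ : ℂ) * hexMidpoint (a δ)) (𝓝[>] 0) (𝓝 (E.pt 0)) →
        ∀ ε : ℝ, 0 < ε → ∀ r : ℝ, 0 < r → ∃ t₀ : ℝ, 0 < t₀ ∧
          ∀ (s : ℝ → Sym2 HexVertex) (t : ℝ), t ≠ 0 → |t| < t₀ →
            (∀ᶠ δ : ℝ in 𝓝[>] 0, s δ ∈ hexDomainBoundary (Λ δ) ∧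
              (hexMidpoint (s δ)).im = (hexMidpoint (a δ)).im) →
            Tendsto (fun δ : ℝ => (δ : ℂ) * hexMidpoint (s δ)) (𝓝[>] 0) (𝓝 (E.pt 0 + t)) →
            ∀ᶠ δ : ℝ in 𝓝[>] 0,
              (∑ γ : HexMidEdgeSAW (Λ δ) (a δ) (s δ),
                  if ∃ v ∈ γ.verts, r ≤ dist ((δ : ℂ) * hexCenter v) ((δ : ℂ) * hexMidpoint (a δ))
                  then hexCriticalFugacity ^ γ.length else 0) ≤
                ε * ∑ γ : HexMidEdgeSAW (Λ δ) (a δ) (s δ), hexCriticalFugacity ^ γ.length)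
    (h7148 : HexSimpleSubseqLimits) :
    Summit.CriticalPhenomena.SAWScalingLimit.Theses.SAWSpinMonotone.ObservableToSLE :=
  observableToSLE_of_bandResidue hR1 h5a1 h7148

end Summit.CriticalPhenomena.SAWScalingLimit.Theorems.ObservableToSLE.TypeLadder

end
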